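import Literature.Analysis.FunctionSpaces.PolchinskiEntropyDerivative
import Literature.Analysis.FunctionSpaces.PolchinskiContinuityAtZero
import Literature.Analysis.FunctionSpaces.PolchinskiGronwall
import Mathlib.Analysis.Calculus.BumpFunction.InnerProduct
import Mathlib.Analysis.Calculus.BumpFunction.FiniteDimension
import Mathlib.Analysis.SpecialFunctions.Log.NegMulLog
import HarnessLib

/-!
# The multiscale Bakry–Émery criterion, proved: `Ent_{ν₀}(F) ≤ 2(∫₀^∞ e^{−2λ_t}dt)·E_{ν₀}[(∇√F)²_{Ċ₀}]`
# for `V₀ ∈ C_b⁴` and smooth `F` with `0 < a ≤ F ≤ b` (Bauerschmidt–Bodineau–Dagallier, Theorem 3)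

Topic `Literature/Analysis/FunctionSpaces`; the capstone of the "proof architecture" files behind the named
fact `Polchinski.BauerschmidtBodineau_multiscaleBakryEmery` ([BBD] Theorem 3, `MultiscaleBakryEmery.lean`).

THIS FILE PROVES [BBD] THEOREM 3 AS A LEAN THEOREM for the following class (hypotheses (H)):
`V₀ ∈ C⁴(ℝ^N)` with bounded derivatives of orders `0..4`; `F ∈ C^∞(ℝ^N)` with bounded derivatives of
orders `0..4` and `0 < a ≤ F ≤ b`; a covariance decomposition `(C_t)` (`Polchinski.CovDecomposition`); the
continuity assumption (e:continuity); the multiscale Bakry–Émery condition (e:assCt-mon) with rates `λ̇_t`,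
`λ_t = ∫₀^t λ̇`, `∫₀^∞ e^{−2λ_t}dt < ∞`.  CONCLUSION ((e:LSI) of [BBD] Thm 3 with `1/γ = ∫₀^∞ e^{−2λ_t}dt`):
`E_{ν₀}[F log F] − E_{ν₀}[F] log E_{ν₀}[F] ≤ 2 (∫₀^∞ e^{−2λ_t}dt) · E_{ν₀}[Σ_{kl} Ċ_0^{kl} ∂_kF ∂_lF /(4F)]`,
i.e. `Ent_{ν₀}(F) ≤ (2/γ) E_{ν₀}[(∇√F)²_{Ċ_0}]`.

Relation to the named fact.  `BauerschmidtBodineau_multiscaleBakryEmery` (still a `def … : Prop`) is typed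
for `V₀` merely measurable and bounded below and `f ∈ C¹_c`; as recorded in `MultiscaleBakryEmery.lean` and
the seat notes, that typing is stronger than what [BBD] prove (their proof needs `P_{0,t}F ∈ C³` and
uniform control of `1/Z_t`).  The present theorem is the honest formalisation of the printed argument for
the smooth bounded class (H) — it covers e.g. bounded `C⁴` perturbations of Gaussian measures, not `φ⁴`
(unbounded `V₀`).  It does NOT discharge the named fact and introduces no new fact.

Proof ([BBD] p0016 L40–153, followed literally): with `Φ` a smooth bounded function equal to `x log x`
on `[a/2, 2b]` (p0016 L40–45), `e(t) = E_{ν_t}[Φ(P_{0,t}F)]` and `k(t) = E_{ν_t}[(∇√P_{0,t}F)²_{Ċ_t}]`: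
`e′ = −2k` on `(0,∞)` (`hasDerivAt_renormExpect_comp_semigroup`, (e:dEnt)); `k′ ≤ −2λ̇k`
(`hasDerivAt_renormExpect_sqrtEnergy_le`, Lemma 1 + (e:assCt-mon)); Grönwall on `[t₀,T]`
(`le_mul_exp_integral_of_hasDerivAt_le`); `t₀ → 0⁺` (`tendsto_renormExpect_*_zero`, `ν_0 = ν₀`,
`P_{0,0} = id`); `T → ∞` by (e:continuity).

No claim about Yang–Mills is made: no gauge-theory instance of (e:assCt-mon) exists in print; the Clay
problem is untouched; in this programme the criterion bears only on the conditional finite-volume rung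
`BalabanLadder.UV` (R4), not on the mass gap.

## Main result (sorry-free; no new definitions, no new named facts)

* **`entropy_le_of_multiscaleBakryEmery`** — [BBD] Theorem 3 for the class (H).

## References

* [BauerschmidtBodineauDagallier2023] R. Bauerschmidt, T. Bodineau, B. Dagallier, *Stochastic dynamics and
  the Polchinski equation: an introduction*, Probab. Surveys 21 (2024) 200–290, arXiv:2307.07619 —
  Theorem 3 p0015 L62–90, proof p0016 L40–153, Lemma 1 p0016–p0017. READ (held text
  `paper:arxiv-2307.07619`).
* [BauerschmidtBodineau2021] R. Bauerschmidt, T. Bodineau, *Log-Sobolev inequality for the continuum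
  sine-Gordon model*, Comm. Pure Appl. Math. 74 (2021) 2064–2113 — the original criterion.
-/

noncomputable section

-- nested operator-norm instances `E →L[ℝ] E →L[ℝ] ℝ`
set_option maxSynthPendingDepth 3

open MeasureTheory ProbabilityTheory Filter Topology Set
open scoped RealInnerProductSpace Matrix MatrixOrder ContDiff

namespace Literature.Analysis.FunctionSpaces

namespace Polchinski

variable {N : ℕ}

/-! ### A smooth bounded function equal to `x log x` on `[a/2, 2b]` ([BBD] p0016 L40–45) -/

section Cutoff

/-- **The cutoff of `x log x`**: for `0 < a ≤ b` there is `Φ ∈ C^∞(ℝ)` with compact support and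
`Φ(x) = x log x` on `[a/2, 2b]` («up to replacing `Φ` by a bounded smooth function that coincides with
`x log x` on `I`», [BBD] p0016 L43–45). [cite: BauerschmidtBodineauDagallier2023, Theorem 3 (proof)] -/
theorem exists_smooth_mul_log {a b : ℝ} (ha : 0 < a) (hab : a ≤ b) :
    ∃ Φ : ℝ → ℝ, ContDiff ℝ ∞ Φ ∧ HasCompactSupport Φ ∧
      ∀ x ∈ Icc (a / 2) (2 * b), Φ x = x * Real.log x := by
  let f : ContDiffBump (a / 4 + b : ℝ) := ⟨b - a / 4, b - a / 8, by linarith, by linarith⟩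
  refine ⟨fun x => f x * (x * Real.log x), ?_, ?_, ?_⟩
  · rw [contDiff_iff_contDiffAt]
    intro x
    by_cases hx : a / 4 < x
    · exact f.contDiffAt.mul (contDiffAt_id.mul (Real.contDiffAt_log.2 (by linarith)))
    · have hev : (fun y => f y * (y * Real.log y)) =ᶠ[𝓝 x] fun _ => (0 : ℝ) := by
        filter_upwards [Iio_mem_nhds (show x < 3 * a / 8 by linarith)] with y hy
        have hy' : y < 3 * a / 8 := hy
        have hns : y ∉ Function.support (f : ℝ → ℝ) := by
          rw [f.support_eq, Metric.mem_ball, Real.dist_eq, abs_lt, show f.rOut = b - a / 8 from rfl]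
          intro h
          linarith [h.1, h.2]
        have hfy : f y = 0 := by simpa [Function.mem_support] using hns
        simp [hfy]
      exact (contDiffAt_const.congr_of_eventuallyEq hev)
  · exact f.hasCompactSupport.mul_right
  · intro x hx
    have h1 : f x = 1 := f.one_of_mem_closedBall (by
      rw [Metric.mem_closedBall, Real.dist_eq, abs_le, show f.rIn = b - a / 4 from rfl]
      constructor <;> linarith [hx.1, hx.2])
    simp [h1]

/-- Derivative data of a smooth compactly supported `Φ : ℝ → ℝ`: `Φ′ = deriv Φ`, `Φ″ = deriv Φ′` with
`HasDerivAt` everywhere, all three bounded, `Φ` and `Φ″` uniformly continuous. [folklore] -/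
private theorem smooth_compact_data {Φ : ℝ → ℝ} (hΦ : ContDiff ℝ ∞ Φ) (hs : HasCompactSupport Φ) :
    (∀ x, HasDerivAt Φ (deriv Φ x) x) ∧ (∀ x, HasDerivAt (deriv Φ) (deriv (deriv Φ) x) x) ∧
    (∃ P0, ∀ x, |Φ x| ≤ P0) ∧ (∃ P1, ∀ x, |deriv Φ x| ≤ P1) ∧ (∃ P2, ∀ x, |deriv (deriv Φ) x| ≤ P2) ∧
    UniformContinuous (deriv (deriv Φ)) ∧ UniformContinuous Φ := by
  obtain ⟨hd0, hΦ1⟩ := contDiff_infty_iff_deriv.1 hΦ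
  obtain ⟨hd1, hΦ2⟩ := contDiff_infty_iff_deriv.1 hΦ1
  have hs1 : HasCompactSupport (deriv Φ) := hs.deriv
  have hs2 : HasCompactSupport (deriv (deriv Φ)) := hs1.deriv
  obtain ⟨P0, hP0⟩ := hΦ.continuous.bounded_above_of_compact_support hs
  obtain ⟨P1, hP1⟩ := hΦ1.continuous.bounded_above_of_compact_support hs1
  obtain ⟨P2, hP2⟩ := hΦ2.continuous.bounded_above_of_compact_support hs2
  refine ⟨fun x => (hd0 x).hasDerivAt, fun x => (hd1 x).hasDerivAt,
    ⟨P0, fun x => by rw [← Real.norm_eq_abs]; exact hP0 x⟩,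
    ⟨P1, fun x => by rw [← Real.norm_eq_abs]; exact hP1 x⟩,
    ⟨P2, fun x => by rw [← Real.norm_eq_abs]; exact hP2 x⟩,
    hs2.uniformContinuous_of_continuous hΦ2.continuous,
    hs.uniformContinuous_of_continuous hΦ.continuous⟩

/-- If `Φ = x log x` on `[a/2, 2b]` then `Φ″(u) = 1/u` for `u ∈ [a,b]` (`0 < a ≤ b`). [folklore] -/
private theorem deriv_deriv_eq_inv {Φ : ℝ → ℝ} {a b : ℝ} (ha : 0 < a)
    (hΦ : ∀ x ∈ Icc (a / 2) (2 * b), Φ x = x * Real.log x) {u : ℝ} (hu : u ∈ Icc a b) :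
    deriv (deriv Φ) u = u⁻¹ := by
  have hab : a ≤ b := hu.1.trans hu.2
  -- `Φ′ = log + 1` on the open interval
  have hd1 : ∀ x ∈ Ioo (a / 2) (2 * b), deriv Φ x = Real.log x + 1 := by
    intro x hx
    have hx0 : x ≠ 0 := by linarith [hx.1]
    have hev : Φ =ᶠ[𝓝 x] fun y => y * Real.log y := by
      filter_upwards [Ioo_mem_nhds hx.1 hx.2] with y hy
      exact hΦ y ⟨hy.1.le, hy.2.le⟩
    rw [hev.deriv_eq]
    exact (Real.hasDerivAt_mul_log hx0).deriv
  have hu' : u ∈ Ioo (a / 2) (2 * b) := ⟨by linarith [hu.1], by linarith [hu.2]⟩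
  have hev : deriv Φ =ᶠ[𝓝 u] fun y => Real.log y + 1 := by
    filter_upwards [Ioo_mem_nhds hu'.1 hu'.2] with y hy
    exact hd1 y hy
  rw [hev.deriv_eq]
  have hu0 : u ≠ 0 := by linarith [hu.1]
  exact ((Real.hasDerivAt_log hu0).add_const 1).deriv

end Cutoff

/-! ### [BBD] Theorem 3 for the class (H) -/

section Main

variable (D : CovDecomposition N) {V₀ F : EuclideanSpace ℝ (Fin N) → ℝ} {BV BF a b : ℝ}

set_option maxHeartbeats 1600000 in
/-- **[BBD] Theorem 3 (multiscale Bakry–Émery criterion ⟹ log-Sobolev / entropy inequality), proved for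
`V₀ ∈ C_b⁴` and smooth `F` with `0 < a ≤ F ≤ b`.**  Let `(C_t)` be a covariance decomposition, `V₀ ∈ C⁴(ℝ^N)`
with bounded derivatives of orders `≤ 4`, and assume the continuity assumption (e:continuity) and the
multiscale condition (e:assCt-mon): `Ċ_t Hess V_t Ċ_t − ½C̈_t ≥ λ̇_t Ċ_t` for all `φ` and `t > 0`, with
`λ̇` locally integrable, `λ_t = ∫₀^t λ̇_s ds` and `∫₀^∞ e^{−2λ_t}dt < ∞`.  Then for every `F ∈ C^∞(ℝ^N)` with
bounded derivatives of orders `≤ 4` and `0 < a ≤ F ≤ b`: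
`E_{ν₀}[F log F] − E_{ν₀}[F] log E_{ν₀}[F] ≤ 2 (∫₀^∞ e^{−2λ_t} dt) · E_{ν₀}[Σ_{kl} Ċ_0^{kl} ∂_kF ∂_lF/(4F)]`,
i.e. (e:LSI) `Ent_{ν₀}(F) ≤ (2/γ)E_{ν₀}[(∇√F)²_{Ċ_0}]` with `1/γ = ∫₀^∞ e^{−2λ_t}dt` ([BBD] Thm 3 p0015 L62–90).
This is the printed theorem for this class of `V₀, F`; it is not the tree's named fact (typed for
measurable `V₀`), and it says nothing about Yang–Mills (no gauge instance of the hypothesis is known).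
[cite: BauerschmidtBodineauDagallier2023, Theorem 3] -/
theorem entropy_le_of_multiscaleBakryEmery
    (hV : ContDiff ℝ 4 V₀) (hVB : ∀ n ≤ 4, ∀ x, ‖iteratedFDeriv ℝ n V₀ x‖ ≤ BV)
    (hF : ContDiff ℝ ∞ F) (hFB : ∀ n ≤ 4, ∀ x, ‖iteratedFDeriv ℝ n F x‖ ≤ BF)
    (ha : 0 < a) (hab : ∀ x, a ≤ F x ∧ F x ≤ b)
    (hCA : ContinuityAssumption D V₀) {lamdot lam : ℝ → ℝ} (hMS : MultiscaleCondition D V₀ lamdot)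
    (hli : ∀ t, 0 ≤ t → IntervalIntegrable lamdot volume 0 t)
    (hlam : ∀ t, 0 ≤ t → lam t = ∫ s in (0 : ℝ)..t, lamdot s)
    (hexp : IntegrableOn (fun t => Real.exp (-2 * lam t)) (Ioi 0)) :
    ∫ φ, F φ * Real.log (F φ) ∂(nu0 D V₀) -
        (∫ φ, F φ ∂(nu0 D V₀)) * Real.log (∫ φ, F φ ∂(nu0 D V₀)) ≤
      2 * (∫ t in Ioi (0 : ℝ), Real.exp (-2 * lam t)) *
        ∫ φ, (1 / 4) * ((∑ k, ∑ l, D.Cdot 0 k l *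
          (fderiv ℝ F φ (EuclideanSpace.single k 1) * fderiv ℝ F φ (EuclideanSpace.single l 1))) *
          (F φ)⁻¹) ∂(nu0 D V₀) := by
  classical
  ---------------------------------------------------------------- data
  have hF4 : ContDiff ℝ 4 F := contDiff_infty.1 hF 4
  have hVc : Continuous V₀ := hV.continuous
  have hFc : Continuous F := hF.continuous
  have hVabs : ∀ x, |V₀ x| ≤ BV := Cb4.abs_le hVB
  have hb : ∀ φ, -BV ≤ V₀ φ := fun φ => (abs_le.1 (hVabs φ)).1
  have hVm : Measurable V₀ := hVc.measurable
  have hFabs : ∀ x, |F x| ≤ BF := Cb4.abs_le hFB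
  haveI := isProbabilityMeasure_nu0 D hVm hb
  obtain ⟨x0⟩ : Nonempty (EuclideanSpace ℝ (Fin N)) := ⟨0⟩
  have hab' : a ≤ b := (hab x0).1.trans (hab x0).2
  have hm : (0 : ℝ) < Real.exp (-BV) := Real.exp_pos _
  have hmZ : ∀ s y, Real.exp (-BV) ≤
      ∫ ζ, Real.exp (-V₀ (y + ζ)) ∂(multivariateGaussian 0 (D.C s)) :=
    fun s y => exp_neg_le_integral_exp_neg hVc hVabs _ y
  have hZpos : ∀ s y, 0 < ∫ ζ, Real.exp (-V₀ (y + ζ)) ∂(multivariateGaussian 0 (D.C s)) :=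
    fun s y => hm.trans_le (hmZ s y)
  have hsemi : ∀ s y, semigroup D V₀ 0 s F y =
      (∫ ζ, Real.exp (-V₀ (y + ζ)) * F (y + ζ) ∂(multivariateGaussian 0 (D.C s))) *
        (∫ ζ, Real.exp (-V₀ (y + ζ)) ∂(multivariateGaussian 0 (D.C s)))⁻¹ := fun s y => by
    rw [semigroup_zero_eq, exp_renormPotential_eq_inv D hVm hb, mul_comm]
  have hu_mem : ∀ s y, a ≤ semigroup D V₀ 0 s F y ∧ semigroup D V₀ 0 s F y ≤ b := fun s y => by
    rw [hsemi, ← div_eq_mul_inv, le_div_iff₀ (hZpos s y), div_le_iff₀ (hZpos s y)]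
    exact integral_exp_neg_mul_mem hVc hVabs hFc hab _ y
  ---------------------------------------------------------------- the cutoff of `x log x`
  obtain ⟨Φ, hΦs, hΦc, hΦeq⟩ := exists_smooth_mul_log ha hab'
  obtain ⟨hd1, hd2, ⟨P0, hP0⟩, ⟨P1, hP1⟩, ⟨P2, hP2⟩, hΦ''u, hΦu⟩ := smooth_compact_data hΦs hΦc
  have hΦ'' : ∀ u ∈ Icc a b, deriv (deriv Φ) u = u⁻¹ := fun u hu => deriv_deriv_eq_inv ha hΦeq hu
  have hΦab : ∀ u ∈ Icc a b, Φ u = u * Real.log u := fun u hu =>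
    hΦeq u ⟨by linarith [hu.1], by linarith [hu.2, hu.1]⟩
  ---------------------------------------------------------------- the two families
  set e : ℝ → ℝ := fun s => renormExpect D V₀ s fun y => Φ (semigroup D V₀ 0 s F y) with he_def
  set k : ℝ → ℝ := fun s => renormExpect D V₀ s fun y =>
    (1 / 4) * ((∑ k, ∑ l, D.Cdot (max s 0) k l *
      (fderiv ℝ (semigroup D V₀ 0 s F) y (EuclideanSpace.single k 1) *
        fderiv ℝ (semigroup D V₀ 0 s F) y (EuclideanSpace.single l 1))) *
      (semigroup D V₀ 0 s F y)⁻¹) with hk_def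
  set I : ℝ := ∫ t in Ioi (0 : ℝ), Real.exp (-2 * lam t) with hI_def
  set K0 : ℝ := ∫ φ, (1 / 4) * ((∑ k, ∑ l, D.Cdot 0 k l *
    (fderiv ℝ F φ (EuclideanSpace.single k 1) * fderiv ℝ F φ (EuclideanSpace.single l 1))) *
    (F φ)⁻¹) ∂(nu0 D V₀) with hK0_def
  set E0 : ℝ := ∫ φ, Φ (F φ) ∂(nu0 D V₀) with hE0_def
  -- (1a) `e′ = −2k` on `(0, ∞)`
  have he' : ∀ t, 0 < t → HasDerivAt e (-2 * k t) t := by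
    intro t ht
    have h := hasDerivAt_renormExpect_comp_semigroup D hV hVB hF4 hFB hd1 hd2 hP0 hP1 hP2 hΦ''u ht
    refine h.congr_deriv ?_
    have hkt : k t = renormExpect D V₀ t fun y => (1 / 4) * ((∑ k, ∑ l, D.Cdot t k l *
        (fderiv ℝ (semigroup D V₀ 0 t F) y (EuclideanSpace.single k 1) *
          fderiv ℝ (semigroup D V₀ 0 t F) y (EuclideanSpace.single l 1))) *
        (semigroup D V₀ 0 t F y)⁻¹) := by
      simp only [hk_def, max_eq_left ht.le]
    rw [hkt, show (-2 : ℝ) * renormExpect D V₀ t _ = -(2 * renormExpect D V₀ t _) by ring,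
      ← renormExpect_const_mul]
    congr 1
    refine congrArg _ (funext fun y => ?_)
    rw [hΦ'' _ (hu_mem t y)]
    have hune : semigroup D V₀ 0 t F y ≠ 0 := (ha.trans_le (hu_mem t y).1).ne'
    field_simp
    ring
  -- (1b) `k′ ≤ −2λ̇k` on `(0, ∞)` and (1c) `k ≥ 0`
  have hk' : ∀ t, 0 < t → ∃ k', HasDerivAt k k' t ∧ k' ≤ -2 * lamdot t * k t := fun t ht =>
    hasDerivAt_renormExpect_sqrtEnergy_le D hV hVB hF4 hFB ha hab hMS ht
  have hk0 : ∀ s, 0 ≤ k s := fun s =>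
    renormExpect_nonneg D s fun y => sqrtEnergy_nonneg D hV hVB hF4 ha hab s y
  have hkc : ∀ t, 0 < t → ContinuousAt k t := fun t ht => by
    obtain ⟨k', h, -⟩ := hk' t ht
    exact h.continuousAt
  -- (1d) limits at `0⁺` and at `∞`
  have he0 : Tendsto e (𝓝[Ici (0 : ℝ)] 0) (𝓝 E0) :=
    tendsto_renormExpect_comp_semigroup_zero D hV hVB hF4 hFB hΦu hP0
  have hklim : Tendsto k (𝓝[Ici (0 : ℝ)] 0) (𝓝 K0) :=
    tendsto_renormExpect_sqrtEnergy_zero D hV hVB hF4 hFB ha hab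
  have heT : Tendsto e atTop (𝓝 (Φ (∫ φ, F φ ∂(nu0 D V₀)))) :=
    hCA F Φ hF ⟨BF, hFabs⟩ hΦs ⟨P0, hP0⟩
  -- continuity of `λ` at `0⁺`
  have hlam0 : Tendsto lam (𝓝[>] (0 : ℝ)) (𝓝 0) := by
    have hc : ContinuousOn (fun t => ∫ s in (0 : ℝ)..t, lamdot s) (uIcc 0 1) :=
      intervalIntegral.continuousOn_primitive_interval' (hli 1 zero_le_one) left_mem_uIcc
    have h0 : (∫ s in (0 : ℝ)..0, lamdot s) = 0 := intervalIntegral.integral_same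
    have hcw := (hc 0 left_mem_uIcc).tendsto
    rw [h0, uIcc_of_le zero_le_one] at hcw
    have h1 : Tendsto (fun t => ∫ s in (0 : ℝ)..t, lamdot s) (𝓝[>] (0 : ℝ)) (𝓝 0) := by
      rw [← nhdsWithin_Ioo_eq_nhdsGT one_pos]
      exact hcw.mono_left (nhdsWithin_mono _ Ioo_subset_Icc_self)
    refine h1.congr' ?_
    filter_upwards [self_mem_nhdsWithin] with t ht
    exact (hlam t (le_of_lt ht)).symm
  ---------------------------------------------------------------- Grönwall + FTC on `[t₀, T]`
  have hmain : ∀ t₀ T, 0 < t₀ → t₀ ≤ T → e t₀ - e T ≤ 2 * (k t₀ * Real.exp (2 * lam t₀)) * I := by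
    intro t₀ T ht₀ hT
    have hkd : ∀ x ∈ Ioo t₀ T, HasDerivAt k (deriv k x) x := fun x hx => by
      obtain ⟨k', h, -⟩ := hk' x (ht₀.trans hx.1)
      exact h.differentiableAt.hasDerivAt
    have hkle : ∀ x ∈ Ioo t₀ T, deriv k x ≤ (-2 * lamdot x) * k x := fun x hx => by
      obtain ⟨k', h, hle⟩ := hk' x (ht₀.trans hx.1)
      rw [h.deriv]
      exact hle
    have hkcont : ContinuousOn k (Icc t₀ T) := fun x hx =>
      (hkc x (ht₀.trans_le hx.1)).continuousWithinAt
    have hlT : IntegrableOn lamdot (Icc t₀ T) := by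
      have h := hli T (ht₀.le.trans hT)
      rw [intervalIntegrable_iff_integrableOn_Ioc_of_le (ht₀.le.trans hT)] at h
      exact h.mono_set fun x hx => ⟨ht₀.trans_le hx.1, hx.2⟩
    have hr : IntegrableOn (fun x => -2 * lamdot x) (Icc t₀ T) := hlT.const_mul (-2)
    have hG : ∀ s ∈ Icc t₀ T, k s ≤ k t₀ * Real.exp (∫ x in t₀..s, -2 * lamdot x) := fun s hs =>
      le_mul_exp_integral_of_hasDerivAt_le hs.1 (hkcont.mono (Icc_subset_Icc_right hs.2))
        (fun x hx => hkd x ⟨hx.1, hx.2.trans_le hs.2⟩) (fun x _ => hk0 x)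
        (hr.mono_set (Icc_subset_Icc_right hs.2)) (fun x hx => hkle x ⟨hx.1, hx.2.trans_le hs.2⟩)
    have hks : ∀ s ∈ Icc t₀ T, k s ≤ k t₀ * Real.exp (2 * lam t₀) * Real.exp (-2 * lam s) := by
      intro s hs
      have h := hG s hs
      have hsub : (∫ x in t₀..s, -2 * lamdot x) = -2 * (lam s - lam t₀) := by
        rw [intervalIntegral.integral_const_mul, hlam s (ht₀.le.trans hs.1), hlam t₀ ht₀.le,
          intervalIntegral.integral_interval_sub_left (hli s (ht₀.le.trans hs.1)) (hli t₀ ht₀.le)]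
      rw [hsub, show (-2 : ℝ) * (lam s - lam t₀) = 2 * lam t₀ + -2 * lam s by ring, Real.exp_add,
        ← mul_assoc] at h
      exact h
    -- FTC for `e`
    have hkI : IntervalIntegrable k volume t₀ T := hkcont.intervalIntegrable_of_Icc hT
    have hint : IntervalIntegrable (fun s => -2 * k s) volume t₀ T := hkI.const_mul (-2)
    have hFTC : (∫ s in t₀..T, -2 * k s) = e T - e t₀ :=
      intervalIntegral.integral_eq_sub_of_hasDerivAt (fun x hx => by
        rw [uIcc_of_le hT] at hx
        exact he' x (ht₀.trans_le hx.1)) hint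
    rw [intervalIntegral.integral_const_mul] at hFTC
    -- the bound on `∫ k`
    have hexpI : IntervalIntegrable (fun s => k t₀ * Real.exp (2 * lam t₀) * Real.exp (-2 * lam s))
        volume t₀ T := by
      refine ((hexp.mono_set ?_).intervalIntegrable).const_mul _
      rw [uIcc_of_le hT]
      exact fun x hx => ht₀.trans_le hx.1
    have hIk : (∫ s in t₀..T, k s) ≤
        ∫ s in t₀..T, k t₀ * Real.exp (2 * lam t₀) * Real.exp (-2 * lam s) :=
      intervalIntegral.integral_mono_on hT hkI hexpI fun s hs => hks s hs
    rw [intervalIntegral.integral_const_mul] at hIk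
    have hI3 : (∫ s in t₀..T, Real.exp (-2 * lam s)) ≤ I := by
      rw [intervalIntegral.integral_of_le hT, hI_def]
      exact setIntegral_mono_set hexp (Eventually.of_forall fun _ => (Real.exp_pos _).le)
        (Eventually.of_forall fun x hx => ht₀.trans hx.1)
    have hkpos : 0 ≤ k t₀ * Real.exp (2 * lam t₀) := mul_nonneg (hk0 t₀) (Real.exp_pos _).le
    nlinarith [mul_le_mul_of_nonneg_left hI3 hkpos]
  ---------------------------------------------------------------- `t₀ → 0⁺`
  have hstep : ∀ T, 0 < T → E0 - e T ≤ 2 * (K0 * Real.exp (2 * 0)) * I := by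
    intro T hT
    have hl : Tendsto (fun t₀ => e t₀ - e T) (𝓝[>] (0 : ℝ)) (𝓝 (E0 - e T)) :=
      (he0.mono_left (nhdsWithin_mono _ Ioi_subset_Ici_self)).sub_const _
    have hr : Tendsto (fun t₀ => 2 * (k t₀ * Real.exp (2 * lam t₀)) * I) (𝓝[>] (0 : ℝ))
        (𝓝 (2 * (K0 * Real.exp (2 * 0)) * I)) :=
      ((hklim.mono_left (nhdsWithin_mono _ Ioi_subset_Ici_self)).mul
        ((Real.continuous_exp.tendsto _).comp (hlam0.const_mul 2))).const_mul 2 |>.mul_const I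
    refine le_of_tendsto_of_tendsto hl hr ?_
    filter_upwards [Ioo_mem_nhdsGT hT] with t₀ ht₀
    exact hmain t₀ T ht₀.1 ht₀.2.le
  simp only [mul_zero, Real.exp_zero, mul_one] at hstep
  ---------------------------------------------------------------- `T → ∞`
  have hfin : E0 - Φ (∫ φ, F φ ∂(nu0 D V₀)) ≤ 2 * K0 * I := by
    have hl : Tendsto (fun T => E0 - e T) atTop (𝓝 (E0 - Φ (∫ φ, F φ ∂(nu0 D V₀)))) :=
      heT.const_sub _
    refine le_of_tendsto_of_tendsto hl tendsto_const_nhds ?_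
    filter_upwards [eventually_gt_atTop (0 : ℝ)] with T hT
    exact hstep T hT
  ---------------------------------------------------------------- the boundary values
  have hFint : Integrable F (nu0 D V₀) :=
    Integrable.of_bound hFc.aestronglyMeasurable BF (Eventually.of_forall fun x => by
      rw [Real.norm_eq_abs]; exact hFabs x)
  have hmean : a ≤ ∫ φ, F φ ∂(nu0 D V₀) ∧ ∫ φ, F φ ∂(nu0 D V₀) ≤ b := by
    constructor
    · have h := integral_mono (integrable_const a) hFint fun x => (hab x).1
      simpa using h
    · have h := integral_mono hFint (integrable_const b) fun x => (hab x).2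
      simpa using h
  have hE0 : E0 = ∫ φ, F φ * Real.log (F φ) ∂(nu0 D V₀) := by
    rw [hE0_def]
    exact integral_congr_ae (Eventually.of_forall fun φ => hΦab _ (hab φ))
  rw [hΦab _ hmean, hE0] at hfin
  calc _ ≤ 2 * K0 * I := hfin
    _ = 2 * I * K0 := by ring

end Main

end Polchinski

end Literature.Analysis.FunctionSpaces

end
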